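import Summits.SmoothPoincare4.SmoothPoincare4.Theorems.CongruenceShadowsNormalFormStablyTrivialSketchTransfer
import Summits.SmoothPoincare4.SmoothPoincare4.Theorems.CongruenceShadowsNormalFormStablyTrivialSketchCalibration

/-!
# `NormalFormStablyTrivial` — line `Sketch`: consequences of the calibration (`X ⇒ K1`)

Crux `CongruenceShadows.NormalFormStablyTrivial` (item stmt-SmoothPoincare4-14591, route
route-SmoothPoincare4-CongruenceShadows), line `Sketch`.  With the calibration of
`…SketchCalibration.lean` (the standard triple `s4Kernels.stabilizeIter M` is isomorphic, by a
handle permutation, to a one-direction connected sum `K'' # eyes (M+1) 0`) the logical position of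
the HARDEST stub K1 `StablyThreeHandleFree` is settled:

* `stablyThreeHandleFree_at_std` — the conclusion of K1 holds at the standard model `K = N` with
  `n = 0`, `j = 0` (so K1 is not refutable "for silly reasons", the failure mode of the sibling idea
  `simplified-tower`);
* `stablyThreeHandleFree_of_agkCondition` (registered sub-goal) — Abrams–Gay–Kirby's condition `X`
  ("every `(3k,k)` group trisection of `{1}` is stably trivial"; hence SPC4 through the `→` half of
  `spc4_iff_forall_isStablyTrivial`) implies K1: `X` makes `K` stably isomorphic to a standard
  triple, the calibration makes the standard triple one-directional, and the two isomorphisms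
  compose AT ONE GENUS (no Nielsen lifting).

Together with `…SketchTransfer.lean`: `X ⇒ K1 ∧ K2 ⇒ NormalFormStablyTrivial`, i.e. the line's
split has exactly the strength of the crux modulo `WaldhausenPairs`, and neither stub is
refutable short of an exotic `S⁴`.  No `sorry`, no named fact.
References: A. Abrams, D. Gay, R. Kirby, Geom. Topol. 22 (2018), Def. 3, Cor. 6.
-/

noncomputable section

-- the prescribed namespace `Summit.<P>.<Sub>.…` duplicates `SmoothPoincare4` (P = Sub)
set_option linter.dupNamespace false

namespace Summit.SmoothPoincare4.SmoothPoincare4.Theorems.NormalFormStablyTrivial.Sketch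

open Literature.Topology.FourManifolds Subgroup
open Summit.SmoothPoincare4.SmoothPoincare4.Theorems.AgkCor6Sufficiency.Negative
  (isGroupTrisection_cast isStablyTrivial_cast_iff iso_cast_iff)

/-- **The conclusion of K1 holds at the standard model** `K = N`, with `n = 0`, `j = 0`
(`calibration`). [folklore] -/
theorem stablyThreeHandleFree_at_std (m : ℕ) :
    ∃ (n : ℕ) (j : Fin 3) (K'' : TrisectionKernels (2 * (m + 1 + n)))
      (h : 3 + 3 * m + 3 * n = 2 * (m + 1 + n) + (m + 1 + n)),
      TrisectionKernels.Iso (((s4Kernels.stabilizeIter m).stabilizeIter n).cast h)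
        (K''.connectSum (fun ι => normalClosure (Set.range fun i : Fin (m + 1 + n) =>
          (PresentedGroup.of (i, decide (ι = j)) : SurfaceGroup (m + 1 + n))))) := by
  obtain ⟨K'', hK''⟩ := calibration m (m + 1 + 0) (by omega) (by omega)
  exact ⟨0, 0, K'', by omega, hK''⟩

/-- **AGK's condition ⇒ K1**: a normalised (indeed any) `(3+3m, m+1)` trisection of `{1}` is stably
isomorphic to a standard triple by `X`, and the standard triple is a one-direction connected sum by
`calibration`; the two isomorphisms compose at one genus (no Nielsen lifting). [folklore] -/
theorem stablyThreeHandleFree_of_agkCondition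
    (hX : ∀ (k : ℕ) (K : TrisectionKernels (3 * k)),
      IsGroupTrisection (3 * k) k (PUnit : Type) K → K.IsStablyTrivial) :
    StablyThreeHandleFree := by
  intro m K hK _
  have e : 3 + 3 * m = 3 * (m + 1) := by ring
  obtain ⟨n, m', h', hiso⟩ :=
    (isStablyTrivial_cast_iff K e).1 (hX (m + 1) (K.cast e) (isGroupTrisection_cast hK e))
  have hm : m' = m + n := by omega
  subst hm
  have h : 3 + 3 * m + 3 * n = 2 * (m + 1 + n) + (m + 1 + n) := by omega
  obtain ⟨K'', hK''⟩ := calibration (m + n) (m + 1 + n) (by omega) (h'.trans h)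
  refine ⟨n, 0, K'', h, ?_⟩
  -- compose `hiso` (at genus `3+3m+3n`) with the calibration, across the cast `h`
  have hiso' : TrisectionKernels.Iso ((K.stabilizeIter n).cast h)
      (((s4Kernels.stabilizeIter (m + n)).cast h').cast h) := (iso_cast_iff h _ _).2 hiso
  rw [AgkCor6Sufficiency.Negative.cast_cast] at hiso'
  -- transitivity of `Iso` at one genus
  obtain ⟨α, hα⟩ := hiso'
  obtain ⟨β, hβ⟩ := hK''
  refine ⟨α.trans β, fun i => ?_⟩
  rw [show (α.trans β).toMonoidHom = β.toMonoidHom.comp α.toMonoidHom from rfl, ← Subgroup.map_map,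
    hα, hβ]

end Summit.SmoothPoincare4.SmoothPoincare4.Theorems.NormalFormStablyTrivial.Sketch

end
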